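import Mathlib
import HarnessLib
import Summits.HubbardSuperconductivity.HubbardSuperconductivity.Theorems.KLProgrammeKLRegimeVolumeLimitSunset
import Summits.HubbardSuperconductivity.HubbardSuperconductivity.Theorems.KLProgrammeKLRegimeVolumeLimitSunsetFrameSymbol

/-!
# Route `KLProgramme` — child `KLRegimeVolumeLimitV7` (stmt-HubbardSuperconductivity-19665), order-`U²` rung of the volume-limit slot:
# the sunset of the FRAME PROPAGATOR satisfies the three clauses of `FinalTwoLegVolLimit`
# (cell gate-hubbard-kl, seat hubbard-kl-k3c4-p1; instance of `…VolumeLimitSunset.klSunset_volLimit` via `…SunsetFrameSymbol`)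

For every `β > 0`, chemical potential `μ`, frame `K` and threshold function `Mstar`, the finite-volume sunset functional of the frame
propagator symbol family `g a x = (e_K(x) - iω_a)⁻¹` (`e_K = bandCT μ K`, `ω_a = fermiMatsubara β a`) has a momentum-continuous limit,
an `n`-uniform bound and per-Matsubara-integer grid convergence, uniformly on the momentum grid, eventually in `L` and then in `M` —
`klSunset_volLimit` with `C = β/2π` (admissibility: `klfs_frameSymbol_continuous/_periodic/_norm_le`).  This is the order-`U²`
(two-loop) WITNESS that the quantifier shape of the VL text is met by the leading momentum-dependent term of the two-leg kernel at
positive temperature; the identification with the `U²`-coefficient of `klSelfEnergy … (nScales β + 1)` is the true-carrier computation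
of the k3c5-p2 lane.  Nothing is asserted about the model.
-/

noncomputable section

namespace Summit.HubbardSuperconductivity.HubbardSuperconductivity.Theorems.KLRegimeSplit

set_option linter.dupNamespace false -- summit = problem name (single-conjunct summit), D-0017

open Real Literature.MathematicalPhysics.QuantumLattice Literature.Probability.LatticeModels
open Summit.HubbardSuperconductivity.HubbardSuperconductivity.Theorems.TwoPointAssembly

/-- **The sunset of the FRAME PROPAGATOR satisfies the three clauses of the volume-limit slot**, for every `β > 0`, `μ`, frame `K`
and threshold function `Mstar` (instance of `klSunset_volLimit` at `g a x = (e_K(x) - iω_a)⁻¹`, `C = β/2π`). -/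
theorem klSunset_frame_volLimit {β : ℝ} (hβ : 0 < β) (μ : ℝ) (K : TrigPolyC4v) (Mstar : ℕ → ℕ) :
    ∃ sigmaInf : ℤ → (Fin 2 → ℝ) → Fin 2 → ℂ, ∃ B : ℝ, ∃ L₀' : ℕ,
      (∀ (n : ℤ) (σ : Fin 2), Continuous fun p : Fin 2 → ℝ => sigmaInf n p σ) ∧
      (∀ (L : ℕ) [NeZero L], L₀' ≤ L → ∀ (M : ℕ) [NeZero M], Mstar L ≤ M →
        ∀ (k : FreqMomentum L M) (σ : Fin 2),
          ‖klSunset L M β (fun a x => ((bandCT μ K x : ℂ) - Complex.I * (fermiMatsubara β a : ℂ))⁻¹) k σ‖ ≤ B) ∧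
      (∀ (n : ℤ) (σ : Fin 2) (ε : ℝ), 0 < ε → ∃ L₁ : ℕ, ∀ (L : ℕ) [NeZero L], L₁ ≤ L →
        ∃ M₁ : ℕ, ∀ (M : ℕ) [NeZero M], M₁ ≤ M → ∀ ω : MatsubaraIdx M, matsubaraInt M ω = n →
          ∀ k : TorusSite 2 L,
            ‖klSunset L M β (fun a x => ((bandCT μ K x : ℂ) - Complex.I * (fermiMatsubara β a : ℂ))⁻¹) (ω, k) σ -
              sigmaInf n (latticeMomentum L k) σ‖ ≤ ε) :=
  klSunset_volLimit hβ (g := fun a x => ((bandCT μ K x : ℂ) - Complex.I * (fermiMatsubara β a : ℂ))⁻¹)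
    (C := β / (2 * π)) (by positivity) (fun a => klfs_frameSymbol_continuous hβ μ K a)
    (fun a x m => klfs_frameSymbol_periodic β μ K a x m) (fun a x => klfs_frameSymbol_norm_le hβ μ K a x) Mstar

end Summit.HubbardSuperconductivity.HubbardSuperconductivity.Theorems.KLRegimeSplit

end
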